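import Literature.IUT.LogVolume.FundamentalIdentity
import Mathlib.NumberTheory.Padics.RingHoms
import HarnessLib

/-!
# Kit for `Thm311RealInd1StripHullIdeals`: a residue count and the `p`-adic gap (classical)

PROOF-ONLY kit file (abc-iut cell, Cor. 3.12 sub-crew, seat abc-iut-c312-1, gen 15; row «R19 = C:IND1-STRIP-OV-HULL»).  Two classical lemmas
about a `p`-adic field `K` in campaign-S's class, used to discharge the general-position hypothesis of `Thm311RealInd1StripHullFloor` for
ideal-shaped regions:

* `padic_norm_le_of_norm_lt` — the `p`-adic gap: `‖a‖ < ‖b‖` in `ℚ_p` forces `‖a‖ ≤ p⁻¹·‖b‖`;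
* `residueDegree_le_one_of_forall_exists_norm_sub_algebraMap_lt_one` — if every unit of `K` is within distance `< 1` of a `p`-adic number,
  then `f(K/ℚ_p) ≤ 1` (every residue class is `[m·1]`, `0 ≤ m < p`, so `p^f = #(𝒪_K/𝔪) ≤ p`; the count of
  `Literature.IUT.LogVolume.TraceZeroCoradial`, p527172).
Nothing here is disputed mathematics; no side taken on [IUTchIII] Cor. 3.12; NO abc claim. [cite: SerreLocalFields1979, Ch. I §6; Ch. III §5]
-/

set_option autoImplicit false

noncomputable section

namespace Summit.ABC.IUTFork.Thm311.Real.Hull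

open Module IsLocalRing Literature.IUT.LogVolume Literature.NumberTheory.GaloisRepresentations.Ultrametric
open scoped NormedField

variable {p : ℕ} [Fact p.Prime]

/-- The `p`-adic gap: `‖a‖ < ‖b‖` in `ℚ_p` forces `‖a‖ ≤ p⁻¹·‖b‖` (value group `p^ℤ`). [folklore] -/
theorem padic_norm_le_of_norm_lt {a b : ℚ_[p]} (h : ‖a‖ < ‖b‖) : ‖a‖ ≤ (p : ℝ)⁻¹ * ‖b‖ := by
  have hb : b ≠ 0 := fun hb => by rw [hb, norm_zero] at h; exact (norm_nonneg a).not_gt h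
  have hb' : 0 < ‖b‖ := norm_pos_iff.mpr hb
  have h1 : ‖a / b‖ < 1 := by rw [norm_div, div_lt_one hb']; exact h
  have h2 : ‖a / b‖ ≤ (p : ℝ)⁻¹ := by
    have h := (Padic.norm_le_pow_iff_norm_lt_pow_add_one (a / b) (-1)).mpr (by simpa using h1)
    simpa using h
  rw [norm_div, div_le_iff₀ hb'] at h2
  exact h2

variable {K : Type} [NontriviallyNormedField K] [NormedAlgebra ℚ_[p] K] [IsUltrametricDist K] [ProperSpace K]

variable (p K) in
/-- **Residue degree one from congruences to `ℚ_p`.**  If every unit of the `p`-adic field `K` is within distance `< 1` of (the image of) a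
`p`-adic number, then `f(K/ℚ_p) ≤ 1`: every residue class of `𝒪_K/𝔪` is `[m·1]` for some `0 ≤ m < p`, so `p^f = #(𝒪_K/𝔪) ≤ p`.
[folklore] -/
theorem residueDegree_le_one_of_forall_exists_norm_sub_algebraMap_lt_one
    (h : ∀ x : K, ‖x‖ = 1 → ∃ s : ℚ_[p], ‖x - algebraMap ℚ_[p] K s‖ < 1) :
    residueDegree p K ≤ 1 := by
  have hP : p.Prime := Fact.out
  let O := Valued.integer K
  haveI : Finite (O ⧸ maximalIdeal O) := (finite_residueField : Finite (ResidueField O))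
  have hsurj : Function.Surjective (fun m : Fin p => Ideal.Quotient.mk (maximalIdeal O) ((m : ℕ) : O)) := by
    intro q
    obtain ⟨x', rfl⟩ := Ideal.Quotient.mk_surjective q
    have hx' : ‖(x' : K)‖ ≤ 1 := Valued.integer.mem_iff.mp x'.2
    rcases hx'.lt_or_eq with hlt | heq
    · refine ⟨⟨0, hP.pos⟩, ?_⟩
      change Ideal.Quotient.mk (maximalIdeal O) (((0 : ℕ) : O)) = Ideal.Quotient.mk (maximalIdeal O) x'
      rw [Ideal.Quotient.eq, mem_maximalIdeal_iff_norm_lt_one, Nat.cast_zero, zero_sub, norm_neg]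
      exact hlt
    · obtain ⟨s, hs⟩ := h (x' : K) heq
      have hs1 : ‖s‖ ≤ 1 := by
        rw [← norm_algebraMap' K s]
        have h2 : algebraMap ℚ_[p] K s = (x' : K) + -((x' : K) - algebraMap ℚ_[p] K s) := by ring
        rw [h2]
        refine (IsUltrametricDist.norm_add_le_max _ _).trans (max_le hx' ?_)
        rw [norm_neg]; exact hs.le
      obtain ⟨m, hmp, hm⟩ := PadicInt.exists_mem_range (⟨s, hs1⟩ : ℤ_[p])
      refine ⟨⟨m, hmp⟩, ?_⟩
      change Ideal.Quotient.mk (maximalIdeal O) (((m : ℕ) : O)) = Ideal.Quotient.mk (maximalIdeal O) x'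
      rw [Ideal.Quotient.eq, mem_maximalIdeal_iff_norm_lt_one]
      have hsm : ‖s - (m : ℚ_[p])‖ < 1 := by
        rw [IsLocalRing.mem_maximalIdeal, PadicInt.mem_nonunits, PadicInt.norm_def, PadicInt.coe_sub,
          PadicInt.coe_natCast] at hm
        exact hm
      have hval : ((((m : ℕ) : O) - x' : O) : K) = -(((x' : K) - algebraMap ℚ_[p] K s) + (algebraMap ℚ_[p] K s - (m : K))) := by
        push_cast; ring
      change ‖((((m : ℕ) : O) - x' : O) : K)‖ < 1
      rw [hval, norm_neg]
      refine lt_of_le_of_lt (IsUltrametricDist.norm_add_le_max _ _) (max_lt hs ?_)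
      rw [← map_natCast (algebraMap ℚ_[p] K) m, ← map_sub, norm_algebraMap']
      exact hsm
  have hcard : Nat.card (O ⧸ maximalIdeal O) ≤ p := by
    have h := Nat.card_le_card_of_surjective _ hsurj
    simpa using h
  have hcardK : Nat.card (O ⧸ maximalIdeal O) = p ^ residueDegree p K := card_residueField p K
  rw [hcardK] at hcard
  have : p ^ residueDegree p K ≤ p ^ 1 := by rw [pow_one]; exact hcard
  exact (Nat.pow_le_pow_iff_right hP.one_lt).mp this

end Summit.ABC.IUTFork.Thm311.Real.Hull


end
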